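import Summits.ValiantsHypothesis.ValiantsHypothesis.Theses.FeketeSOS

/-!
# `FeketeNoSparseSplit` (crux stmt-ValiantsHypothesis-3997): the PLACE must lie over `p` — the mod-2 shadow
of the line's bound is false

Negative-side load-bearing fact for the line `Cruxes/FeketeNoSparseSplit/Lines/cyclic-valuation-dichotomy.lean`
(cdisprove cycle 2, refuter-cdisprove-stmt-ValiantsHypothesis-3997-g2-0; BarrierNotes-ideator3 §B2 made a theorem),
PROVED, no new facts.  The line reduces a complex splitting `A·B = F_p` at a place of `ℂ` above `p` and wins because
`F̄_p` vanishes to order `(p-1)/2` at `1` in characteristic `p` (Euler's criterion).  Reducing at a place above `2`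
instead sees NOTHING: modulo `2` the Legendre symbol is the constant `1` on `[1, p-1]` (`fekete_mod_two_eq`:
`F_p ≡ X·(1 + X + ⋯ + X^{p-2})`), and the all-ones polynomial digit-tiles, `fekete_mod_two_digit_split`: for EVERY
factorisation `p - 1 = a·t`, `F_p ≡ (X·Σ_{i<a} X^i)·(Σ_{j<t} X^{aj}) (mod 2)` with support-sum `≤ a + t` — e.g.
`p = 17`: `8 < 10 = (17+3)/2` (`fekete_seventeen_mod_two_split`), so `not_feketeModTwoShadowBound`: the mod-2
analogue of the line's `C⁺`/`(p+3)/2` bound is FALSE.  (Asymptotically the mod-2 shadow even fails the crux's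
exponent `1/2 + δ` along the primes `p` for which `p - 1` has a divisor in `[p^{1/2-δ}, p^{1/2}]` — infinitely many
for every `δ > 0` by Ford's theorem on divisors of shifted primes (Ann. of Math. 168 (2008), Thm. 6); not formalised,
it needs that distributional input.)  For an odd prime `ℓ ≠ p` the signs survive reduction but Euler's criterion does
not, so the order of `F_p mod ℓ` at `1` is generically `≤ 2` and the multiplicity lever gives nothing either: the
place over `p` itself is the load-bearing choice, complementing `FalseWithoutLegendre` (the values) and
`SmallModels`/`StubHypotheses` (prime modulus, `deg < p`).
-/

namespace Summit.ValiantsHypothesis.Theorems.FeketeNoSparseSplit.Negative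

open Polynomial Finset

section Tiling

variable (R : Type*) [CommRing R]

/-- Digit tiling over any commutative ring: `(Σ_{i<a} X^i)·(Σ_{j<t} X^{aj}) = Σ_{m<at} X^m`. [folklore] -/
theorem geom_mul_comb (a t : ℕ) :
    (∑ i ∈ range a, (X : R[X]) ^ i) * (∑ j ∈ range t, (X : R[X]) ^ (a * j)) =
      ∑ m ∈ range (a * t), (X : R[X]) ^ m := by
  induction t with
  | zero => simp
  | succ t ih =>
    rw [Finset.sum_range_succ, mul_add, ih, Nat.mul_succ, Finset.sum_range_add, Finset.sum_mul]
    congr 1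
    refine Finset.sum_congr rfl fun i _ => ?_
    rw [← pow_add, add_comm]

/-- A sum of `k` powers of `X` has at most `k` monomials. [folklore] -/
theorem card_support_sum_X_pow_le (f : ℕ → ℕ) (k : ℕ) :
    (∑ i ∈ range k, (X : R[X]) ^ f i).support.card ≤ k := by
  induction k with
  | zero => simp
  | succ k ih =>
    rw [Finset.sum_range_succ]
    refine (Finset.card_le_card support_add).trans ((Finset.card_union_le _ _).trans ?_)
    have h1 : ((X : R[X]) ^ f k).support.card ≤ 1 := by
      rw [← one_mul ((X : R[X]) ^ f k), ← C_1]
      exact card_support_C_mul_X_pow_le_one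
    omega

end Tiling

/-- **Modulo 2 the Legendre symbol is invisible**: `F_p ≡ X·(1 + X + ⋯ + X^{p-2}) (mod 2)` for every prime `p`
(`(m|p) = ±1 ≡ 1` for `1 ≤ m < p`). [folklore] -/
theorem fekete_mod_two_eq (p : ℕ) [Fact p.Prime] :
    (∑ m ∈ Finset.range p, C ((legendreSym p m : ℤ) : ZMod 2) * X ^ m) =
      X * ∑ i ∈ Finset.range (p - 1), (X : (ZMod 2)[X]) ^ i := by
  have hp : p.Prime := Fact.out
  have hr : Finset.range p = Finset.range (p - 1 + 1) := by
    congr 1; have := hp.one_lt; omega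
  rw [hr, Finset.sum_range_succ']
  simp only [Nat.cast_zero, legendreSym.at_zero, Int.cast_zero, map_zero, zero_mul, add_zero]
  rw [Finset.mul_sum]
  refine Finset.sum_congr rfl fun i hi => ?_
  rw [Finset.mem_range] at hi
  have hne : ((((i + 1 : ℕ) : ℤ)) : ZMod p) ≠ 0 := by
    rw [Int.cast_natCast, Ne, ZMod.natCast_eq_zero_iff]
    exact Nat.not_dvd_of_pos_of_lt (by omega) (by omega)
  have h1 : (((legendreSym p ((i + 1 : ℕ) : ℤ)) : ℤ) : ZMod 2) = 1 := by
    rcases legendreSym.eq_one_or_neg_one p hne with h | h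
    · rw [h]; simp
    · rw [h]; decide
  rw [h1, map_one, one_mul, pow_succ']

/-- **Digit splittings of the mod-2 shadow**: for every factorisation `p - 1 = a·t`,
`F_p ≡ (X·Σ_{i<a} X^i)·(Σ_{j<t} X^{aj}) (mod 2)`, with `|supp A| ≤ a`, `|supp B| ≤ t`. [folklore] -/
theorem fekete_mod_two_digit_split (p : ℕ) [Fact p.Prime] (a t : ℕ) (hat : a * t = p - 1) :
    ∃ A B : (ZMod 2)[X],
      A * B = ∑ m ∈ Finset.range p, C ((legendreSym p m : ℤ) : ZMod 2) * X ^ m ∧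
      A.support.card ≤ a ∧ B.support.card ≤ t := by
  refine ⟨X * ∑ i ∈ range a, X ^ i, ∑ j ∈ range t, X ^ (a * j), ?_, ?_, ?_⟩
  · rw [fekete_mod_two_eq, mul_assoc, geom_mul_comb, hat]
  · refine (card_support_mul_le).trans ?_
    rw [support_X, Finset.card_singleton, one_mul]
    exact card_support_sum_X_pow_le (ZMod 2) (fun i => i) a
  · exact card_support_sum_X_pow_le (ZMod 2) (fun j => a * j) t

/-- `17` is prime (local instance). [folklore] -/
theorem fact_prime_seventeen : Fact (Nat.Prime 17) := ⟨by norm_num⟩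

attribute [local instance] fact_prime_seventeen

/-- `p = 17 = 4·4 + 1`: modulo `2`, `F_17 ≡ (X + X² + X³ + X⁴)·(1 + X⁴ + X⁸ + X¹²)`, support-sum `≤ 8 < 10 = (17+3)/2`
— below the line's bound, which every COMPLEX splitting of `F_17` respects (exhaustive minimum `14`). [folklore] -/
theorem fekete_seventeen_mod_two_split : ∃ A B : (ZMod 2)[X],
    A * B = ∑ m ∈ Finset.range 17, C ((legendreSym 17 m : ℤ) : ZMod 2) * X ^ m ∧
    A.support.card + B.support.card < (17 + 3) / 2 := by
  obtain ⟨A, B, h, hA, hB⟩ := fekete_mod_two_digit_split 17 4 4 (by norm_num)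
  exact ⟨A, B, h, by omega⟩

/-- **The mod-2 shadow of the line's bound is FALSE** (so the place of reduction must lie over `p`): it is not
true that for every odd prime `p` every factorisation of `F_p mod 2` in `𝔽₂[X]` has support-sum `≥ (p+3)/2`
(witness `p = 17`, support-sum `8`). [folklore] -/
theorem not_feketeModTwoShadowBound :
    ¬ ∀ (p : ℕ) [Fact p.Prime], p ≠ 2 → ∀ A B : (ZMod 2)[X],
        A * B = ∑ m ∈ Finset.range p, C ((legendreSym p m : ℤ) : ZMod 2) * X ^ m →
        (p + 3) / 2 ≤ A.support.card + B.support.card := by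
  intro H
  obtain ⟨A, B, h, hlt⟩ := fekete_seventeen_mod_two_split
  have := H 17 (by norm_num) A B h
  omega

end Summit.ValiantsHypothesis.Theorems.FeketeNoSparseSplit.Negative
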